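import Summits.Ventures.QEC.Census.BZAssembly
import Literature.InformationTheory.QuantumCodes.AutomorphismLabelAction
import Literature.InformationTheory.QuantumCodes.TwoBlockOrbitReduction
import Literature.InformationTheory.QuantumCodes.BBEvenDistance
import HarnessLib

/-!
# Brouwer–Zimmermann certificates with automorphisms (`bz_aut`): glue to the label action, and the
# bivariate-bicycle specialisation (plan/CERT-FORMAT.md v1.1 §4 L5 + L6, §5.5; BZ-CHECKER-SPEC §L)

Companion of `Census/BZAssembly.lean` (method `bz`: labels, `bz_block`, `bz_cover`, packaged `forall_lt_of_bz`).
`Literature/…/AutomorphismLabelAction.lean` (qec-type-12, p467242) proves the LABEL ACTION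
`LX *ᵥ (z ∘ σ⁻¹) = (LX * (LZ.submatrix id σ⁻¹)ᵀ) *ᵥ (LX *ᵥ z)` and a cover theorem
`CSSCode.lt_hammingNorm_of_label_cover` whose inputs are (i) the expansion property
`hexp : z − (LX *ᵥ z) ᵥ* LZ ∈ rs H^Z`, (ii) row-MAP automorphisms `H.submatrix ρ σ = H` (`ρ` any function on rows
— exactly a checker's "row `i` permuted is row `ρ i`", obligation O7a), (iii) `hCert : |z| ≤ wmax ∧ Cert (LX *ᵥ z)
→ z ∈ rs H^Z`. Here: (i) from the checker hypotheses `(hdual, hpair, hdec)` (`sub_vecMul_mem_rowSpZ`; `hdec` is the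
shape of type-10's `CertLogical.exists_coeffs_of_ker`), (iii) from the per-block conclusions of `bz_block`
(`mem_rowSpZ_of_blocks`), then the END-TO-END statements for method `bz_aut` with a uniform block shape
(`forall_lt_of_bzAut`, `dZ_eq_of_bzAut`; `X` side = the same for `C.swap`), and the bivariate-bicycle
specialisation in which the automorphisms are the translations of `ℤ_ℓ × ℤ_m`, which need NO row-image replay
(`BB.Code.HX_submatrix_translate`, type-12 p461461): `BB.forall_lt_of_bzAut_translate`,
`BB.dZ_eq_of_bzAut_translate`, `BB.d_eq_of_bzAut_translate` (with Lemma 1's `d = d^Z`, type-05 `BB.Code.d_eq_dZ`) —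
the kernel-A path for `[[144,12,12]]` (director D8/P1: 15 representative blocks per side, 2.43·10⁸ visits).

HONEST FRAMING: propositional layer only; the Boolean replay (C1–C5) and the bitmask bridge are type-10's
`CertCheckBZ.lean`; no distance VALUE is asserted here.
-/

namespace Summit.Ventures.QEC.Census

open Matrix Finset Module Literature.InformationTheory.QuantumCodes Literature.InformationTheory.Coding

variable {RX RZ Q : Type*} [Fintype RX] [Fintype RZ] [Fintype Q] [DecidableEq Q] {k : ℕ}

/-! ## Glue: expansion property and `hCert` from the checker's hypotheses -/

section BzAut

variable (C : CSSCode RX RZ Q) {L Ld : Matrix (Fin k) Q (ZMod 2)}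

omit [Fintype RX] [DecidableEq Q] in
/-- The expansion property `hexp` of `AutomorphismLabelAction.lean` from the checker's data: duals in `ker H^Z`,
pairing `Ld_j ⬝ L_i = [i = j]`, and L1's `∃ a, z − Σ aᵢ Lᵢ ∈ rs H^Z` give `z − (Ld *ᵥ z) ᵥ* L ∈ rs H^Z`. -/
theorem sub_vecMul_mem_rowSpZ (hdual : ∀ j, C.HZ *ᵥ Ld j = 0)
    (hpair : ∀ i j, Ld j ⬝ᵥ L i = if i = j then 1 else 0)
    (hdec : ∀ z : Q → ZMod 2, C.HX *ᵥ z = 0 → ∃ a : Fin k → ZMod 2, z - ∑ i, a i • L i ∈ C.rowSpZ)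
    {z : Q → ZMod 2} (hz : C.HX *ᵥ z = 0) : z - (Ld *ᵥ z) ᵥ* L ∈ C.rowSpZ := by
  rw [Matrix.vecMul_eq_sum]
  exact sub_sum_mulVec_smul_mem_rowSpZ C hdual hpair (hdec z hz)

omit [Fintype RX] [DecidableEq Q] in
/-- The `hCert` input of `CSSCode.lt_hammingNorm_of_label_cover` from per-block conclusions: if every
non-trivial `Z`-logical with label in `S b` has weight `> wmax` (`bz_block`), then a `z ∈ ker H^X` of weight
`≤ wmax` whose label lies in some `S b` is a stabilizer. -/
theorem mem_rowSpZ_of_blocks {β : Type*} (S : β → Set (Fin k → ZMod 2)) {wmax : ℕ}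
    (hblock : ∀ b (z : Q → ZMod 2), C.HX *ᵥ z = 0 → z ∉ C.rowSpZ → Ld *ᵥ z ∈ S b → wmax < hammingNorm z)
    {z : Q → ZMod 2} (hz : C.HX *ᵥ z = 0) (hle : hammingNorm z ≤ wmax) (hc : ∃ b, Ld *ᵥ z ∈ S b) :
    z ∈ C.rowSpZ := by
  by_contra hz'
  obtain ⟨b, hb⟩ := hc
  exact absurd (hblock b z hz hz' hb) (not_lt.2 hle)

/-- **Method `bz_aut`, end to end (lower half of `sideOK`, CERT-FORMAT v1.1 §5.5).** Blocks `b < nb` as in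
`forall_lt_of_bz` (only the REPRESENTATIVE blocks are certified), a family of row-map automorphisms
`(σ a, ρX a, ρZ a)` of both check matrices (C5 row-image checks), and the cover "every non-zero label lies in some
`span (W b)` directly or after transport by some listed `σ a`" with the label-action matrix
`Ld * (L.submatrix id (σ a)⁻¹)ᵀ` of type-12's `label_comp_equiv_symm` (its column `i` = label of `L_i ∘ (σ a)⁻¹`,
C5's `ρ_a`) ⇒ every non-trivial `Z`-logical has weight `> wmax`. -/
theorem forall_lt_of_bzAut (hdual : ∀ j, C.HZ *ᵥ Ld j = 0) (hpair : ∀ i j, Ld j ⬝ᵥ L i = if i = j then 1 else 0)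
    (hdec : ∀ z : Q → ZMod 2, C.HX *ᵥ z = 0 → ∃ a : Fin k → ZMod 2, z - ∑ i, a i • L i ∈ C.rowSpZ)
    {nb kb jW m : ℕ} {Gb : Fin nb → Fin kb → Q → ZMod 2}
    (hrows : ∀ b, C.rowSpZ ≤ Submodule.span (ZMod 2) (Set.range (Gb b)))
    {W : Fin nb → Fin jW → Fin k → ZMod 2}
    (hW : ∀ b l, ∑ i, W b l i • L i ∈ Submodule.span (ZMod 2) (Set.range (Gb b)))
    {G : Fin nb → Fin m → Fin kb → Q → ZMod 2} {T : Fin nb → Fin m → Fin kb → Q}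
    (hsys : ∀ b i j j', G b i j (T b i j') = if j = j' then 1 else 0)
    (hG : ∀ b i j, G b i j ∈ Submodule.span (ZMod 2) (Set.range (Gb b)))
    {t : Fin nb → Fin m → ℕ} {wmax : ℕ}
    (henum : ∀ b i (a : Fin kb → ZMod 2), 1 ≤ hammingNorm a → hammingNorm a ≤ t b i →
      hammingNorm (∑ j, a j • G b i j) ≤ wmax → (∑ j, a j • G b i j) ∈ C.rowSpZ)
    (hbound : ∀ b, wmax < bzBound (T b) (t b))
    {A : Type*} {σ : A → Q ≃ Q} {ρX : A → RX → RX} {ρZ : A → RZ → RZ}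
    (hσX : ∀ a, C.HX.submatrix (ρX a) (σ a) = C.HX) (hσZ : ∀ a, C.HZ.submatrix (ρZ a) (σ a) = C.HZ)
    (hcover : ∀ lam : Fin k → ZMod 2, lam ≠ 0 →
      (∃ b, lam ∈ Submodule.span (ZMod 2) (Set.range (W b))) ∨
        ∃ a b, (Ld * (L.submatrix id (σ a).symm)ᵀ) *ᵥ lam ∈ Submodule.span (ZMod 2) (Set.range (W b)))
    {z : Q → ZMod 2} (hz : C.HX *ᵥ z = 0) (hz' : z ∉ C.rowSpZ) : wmax < hammingNorm z := by
  refine C.lt_hammingNorm_of_label_cover (LX := Ld) (LZ := L) hdual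
    (fun w hw => sub_vecMul_mem_rowSpZ C hdual hpair hdec hw) hσX hσZ
    (Cert := fun lam => ∃ b, lam ∈ (Submodule.span (ZMod 2) (Set.range (W b)) : Set (Fin k → ZMod 2)))
    (fun w hw hle hc => mem_rowSpZ_of_blocks (Ld := Ld) C
      (fun b => (Submodule.span (ZMod 2) (Set.range (W b)) : Set (Fin k → ZMod 2)))
      (fun b v hv hv' hlab => bz_block C hdual hpair hdec (hrows b) (hW b) (hsys b) (hG b) (henum b) (hbound b)
        hv hv' hlab) hw hle hc)
    (fun lam hlam => ?_) hz hz'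
  rcases hcover lam hlam with ⟨b, hb⟩ | ⟨a, b, hab⟩
  · exact Or.inl ⟨b, hb⟩
  · exact Or.inr ⟨a, b, hab⟩

/-- **Method `bz_aut`, the distance**: `forall_lt_of_bzAut` + an upper witness of weight `wmax + 1` ⇒
`dZ = wmax + 1`. -/
theorem dZ_eq_of_bzAut (hdual : ∀ j, C.HZ *ᵥ Ld j = 0) (hpair : ∀ i j, Ld j ⬝ᵥ L i = if i = j then 1 else 0)
    (hdec : ∀ z : Q → ZMod 2, C.HX *ᵥ z = 0 → ∃ a : Fin k → ZMod 2, z - ∑ i, a i • L i ∈ C.rowSpZ)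
    {nb kb jW m : ℕ} {Gb : Fin nb → Fin kb → Q → ZMod 2}
    (hrows : ∀ b, C.rowSpZ ≤ Submodule.span (ZMod 2) (Set.range (Gb b)))
    {W : Fin nb → Fin jW → Fin k → ZMod 2}
    (hW : ∀ b l, ∑ i, W b l i • L i ∈ Submodule.span (ZMod 2) (Set.range (Gb b)))
    {G : Fin nb → Fin m → Fin kb → Q → ZMod 2} {T : Fin nb → Fin m → Fin kb → Q}
    (hsys : ∀ b i j j', G b i j (T b i j') = if j = j' then 1 else 0)
    (hG : ∀ b i j, G b i j ∈ Submodule.span (ZMod 2) (Set.range (Gb b)))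
    {t : Fin nb → Fin m → ℕ} {wmax : ℕ}
    (henum : ∀ b i (a : Fin kb → ZMod 2), 1 ≤ hammingNorm a → hammingNorm a ≤ t b i →
      hammingNorm (∑ j, a j • G b i j) ≤ wmax → (∑ j, a j • G b i j) ∈ C.rowSpZ)
    (hbound : ∀ b, wmax < bzBound (T b) (t b))
    {A : Type*} {σ : A → Q ≃ Q} {ρX : A → RX → RX} {ρZ : A → RZ → RZ}
    (hσX : ∀ a, C.HX.submatrix (ρX a) (σ a) = C.HX) (hσZ : ∀ a, C.HZ.submatrix (ρZ a) (σ a) = C.HZ)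
    (hcover : ∀ lam : Fin k → ZMod 2, lam ≠ 0 →
      (∃ b, lam ∈ Submodule.span (ZMod 2) (Set.range (W b))) ∨
        ∃ a b, (Ld * (L.submatrix id (σ a).symm)ᵀ) *ᵥ lam ∈ Submodule.span (ZMod 2) (Set.range (W b)))
    {v : Q → ZMod 2} (hv : C.HX *ᵥ v = 0) (hv' : v ∉ C.rowSpZ) (hwt : hammingNorm v = wmax + 1) :
    C.dZ = wmax + 1 :=
  dZ_eq_succ_of_forall_lt C hv hv' hwt fun _ hw hw' =>
    forall_lt_of_bzAut C hdual hpair hdec hrows hW hsys hG henum hbound hσX hσZ hcover hw hw'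

end BzAut

/-! ## Bivariate-bicycle codes: `bz_aut` with the translations of `ℤ_ℓ × ℤ_m` (no row-image check needed) -/

section BB

open Literature.InformationTheory.QuantumCodes.BB

variable {ℓ m : ℕ} [NeZero ℓ] [NeZero m] (C : BB.Code ℓ m) {k : ℕ}
  {L Ld : Matrix (Fin k) (Mono ℓ m ⊕ Mono ℓ m) (ZMod 2)}

/-- **`bz_aut` for `QC(A, B)` with translation automorphisms.** As `forall_lt_of_bzAut` for `C.css`, the listed
automorphisms being translations `BB.Code.translate (τ a)` (both blocks shifted by `τ a ∈ ℤ_ℓ × ℤ_m`), which ARE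
automorphisms of `H^X` and `H^Z` by `BB.Code.HX_submatrix_translate` / `HZ_submatrix_translate` (type-12) — so a
certificate lists group elements, not permutations, and obligation O7a is a theorem. -/
theorem BB.forall_lt_of_bzAut_translate (hdual : ∀ j, C.HZ *ᵥ Ld j = 0)
    (hpair : ∀ i j, Ld j ⬝ᵥ L i = if i = j then 1 else 0)
    (hdec : ∀ z, C.HX *ᵥ z = 0 → ∃ a : Fin k → ZMod 2, z - ∑ i, a i • L i ∈ C.css.rowSpZ)
    {nb kb jW mm : ℕ} {Gb : Fin nb → Fin kb → (Mono ℓ m ⊕ Mono ℓ m) → ZMod 2}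
    (hrows : ∀ b, C.css.rowSpZ ≤ Submodule.span (ZMod 2) (Set.range (Gb b)))
    {W : Fin nb → Fin jW → Fin k → ZMod 2}
    (hW : ∀ b l, ∑ i, W b l i • L i ∈ Submodule.span (ZMod 2) (Set.range (Gb b)))
    {G : Fin nb → Fin mm → Fin kb → (Mono ℓ m ⊕ Mono ℓ m) → ZMod 2}
    {T : Fin nb → Fin mm → Fin kb → (Mono ℓ m ⊕ Mono ℓ m)}
    (hsys : ∀ b i j j', G b i j (T b i j') = if j = j' then 1 else 0)
    (hG : ∀ b i j, G b i j ∈ Submodule.span (ZMod 2) (Set.range (Gb b)))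
    {t : Fin nb → Fin mm → ℕ} {wmax : ℕ}
    (henum : ∀ b i (a : Fin kb → ZMod 2), 1 ≤ hammingNorm a → hammingNorm a ≤ t b i →
      hammingNorm (∑ j, a j • G b i j) ≤ wmax → (∑ j, a j • G b i j) ∈ C.css.rowSpZ)
    (hbound : ∀ b, wmax < bzBound (T b) (t b))
    {A : Type*} (τ : A → Mono ℓ m)
    (hcover : ∀ lam : Fin k → ZMod 2, lam ≠ 0 →
      (∃ b, lam ∈ Submodule.span (ZMod 2) (Set.range (W b))) ∨
        ∃ a b, (Ld * (L.submatrix id (BB.Code.translate (τ a)).symm)ᵀ) *ᵥ lam ∈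
          Submodule.span (ZMod 2) (Set.range (W b)))
    {z : Mono ℓ m ⊕ Mono ℓ m → ZMod 2} (hz : C.HX *ᵥ z = 0) (hz' : z ∉ C.css.rowSpZ) :
    wmax < hammingNorm z :=
  forall_lt_of_bzAut C.css hdual hpair hdec hrows hW hsys hG henum hbound
    (σ := fun a => BB.Code.translate (τ a)) (ρX := fun a => Equiv.addRight (τ a))
    (ρZ := fun a => Equiv.addRight (τ a))
    (fun a => C.HX_submatrix_translate (τ a)) (fun a => C.HZ_submatrix_translate (τ a)) hcover hz hz'

/-- **`bz_aut` distance for `QC(A, B)`** from translations + an upper `Z`-witness: `C.css.dZ = wmax + 1`. -/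
theorem BB.dZ_eq_of_bzAut_translate (hdual : ∀ j, C.HZ *ᵥ Ld j = 0)
    (hpair : ∀ i j, Ld j ⬝ᵥ L i = if i = j then 1 else 0)
    (hdec : ∀ z, C.HX *ᵥ z = 0 → ∃ a : Fin k → ZMod 2, z - ∑ i, a i • L i ∈ C.css.rowSpZ)
    {nb kb jW mm : ℕ} {Gb : Fin nb → Fin kb → (Mono ℓ m ⊕ Mono ℓ m) → ZMod 2}
    (hrows : ∀ b, C.css.rowSpZ ≤ Submodule.span (ZMod 2) (Set.range (Gb b)))
    {W : Fin nb → Fin jW → Fin k → ZMod 2}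
    (hW : ∀ b l, ∑ i, W b l i • L i ∈ Submodule.span (ZMod 2) (Set.range (Gb b)))
    {G : Fin nb → Fin mm → Fin kb → (Mono ℓ m ⊕ Mono ℓ m) → ZMod 2}
    {T : Fin nb → Fin mm → Fin kb → (Mono ℓ m ⊕ Mono ℓ m)}
    (hsys : ∀ b i j j', G b i j (T b i j') = if j = j' then 1 else 0)
    (hG : ∀ b i j, G b i j ∈ Submodule.span (ZMod 2) (Set.range (Gb b)))
    {t : Fin nb → Fin mm → ℕ} {wmax : ℕ}
    (henum : ∀ b i (a : Fin kb → ZMod 2), 1 ≤ hammingNorm a → hammingNorm a ≤ t b i →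
      hammingNorm (∑ j, a j • G b i j) ≤ wmax → (∑ j, a j • G b i j) ∈ C.css.rowSpZ)
    (hbound : ∀ b, wmax < bzBound (T b) (t b))
    {A : Type*} (τ : A → Mono ℓ m)
    (hcover : ∀ lam : Fin k → ZMod 2, lam ≠ 0 →
      (∃ b, lam ∈ Submodule.span (ZMod 2) (Set.range (W b))) ∨
        ∃ a b, (Ld * (L.submatrix id (BB.Code.translate (τ a)).symm)ᵀ) *ᵥ lam ∈
          Submodule.span (ZMod 2) (Set.range (W b)))
    {v : Mono ℓ m ⊕ Mono ℓ m → ZMod 2} (hv : C.HX *ᵥ v = 0) (hv' : v ∉ C.css.rowSpZ)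
    (hwt : hammingNorm v = wmax + 1) : C.css.dZ = wmax + 1 :=
  dZ_eq_succ_of_forall_lt C.css hv hv' hwt fun _ hw hw' =>
    BB.forall_lt_of_bzAut_translate C hdual hpair hdec hrows hW hsys hG henum hbound τ hcover hw hw'

/-- **The printed distance `d` of `QC(A, B)` from a ONE-SIDED `bz_aut` certificate**: `C.d = wmax + 1`, using
Lemma 1's `d = d^Z` (`BB.Code.d_eq_dZ`, type-05) — the `X` side needs no certificate. -/
theorem BB.d_eq_of_bzAut_translate (hdual : ∀ j, C.HZ *ᵥ Ld j = 0)
    (hpair : ∀ i j, Ld j ⬝ᵥ L i = if i = j then 1 else 0)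
    (hdec : ∀ z, C.HX *ᵥ z = 0 → ∃ a : Fin k → ZMod 2, z - ∑ i, a i • L i ∈ C.css.rowSpZ)
    {nb kb jW mm : ℕ} {Gb : Fin nb → Fin kb → (Mono ℓ m ⊕ Mono ℓ m) → ZMod 2}
    (hrows : ∀ b, C.css.rowSpZ ≤ Submodule.span (ZMod 2) (Set.range (Gb b)))
    {W : Fin nb → Fin jW → Fin k → ZMod 2}
    (hW : ∀ b l, ∑ i, W b l i • L i ∈ Submodule.span (ZMod 2) (Set.range (Gb b)))
    {G : Fin nb → Fin mm → Fin kb → (Mono ℓ m ⊕ Mono ℓ m) → ZMod 2}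
    {T : Fin nb → Fin mm → Fin kb → (Mono ℓ m ⊕ Mono ℓ m)}
    (hsys : ∀ b i j j', G b i j (T b i j') = if j = j' then 1 else 0)
    (hG : ∀ b i j, G b i j ∈ Submodule.span (ZMod 2) (Set.range (Gb b)))
    {t : Fin nb → Fin mm → ℕ} {wmax : ℕ}
    (henum : ∀ b i (a : Fin kb → ZMod 2), 1 ≤ hammingNorm a → hammingNorm a ≤ t b i →
      hammingNorm (∑ j, a j • G b i j) ≤ wmax → (∑ j, a j • G b i j) ∈ C.css.rowSpZ)
    (hbound : ∀ b, wmax < bzBound (T b) (t b))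
    {A : Type*} (τ : A → Mono ℓ m)
    (hcover : ∀ lam : Fin k → ZMod 2, lam ≠ 0 →
      (∃ b, lam ∈ Submodule.span (ZMod 2) (Set.range (W b))) ∨
        ∃ a b, (Ld * (L.submatrix id (BB.Code.translate (τ a)).symm)ᵀ) *ᵥ lam ∈
          Submodule.span (ZMod 2) (Set.range (W b)))
    {v : Mono ℓ m ⊕ Mono ℓ m → ZMod 2} (hv : C.HX *ᵥ v = 0) (hv' : v ∉ C.css.rowSpZ)
    (hwt : hammingNorm v = wmax + 1) : C.d = wmax + 1 := by
  rw [C.d_eq_dZ]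
  exact BB.dZ_eq_of_bzAut_translate C hdual hpair hdec hrows hW hsys hG henum hbound τ hcover hv hv' hwt

end BB

/-! ## Parity-aware closers (CERT-FORMAT L7): certify to `weff = d − 2`, lift by even weights

(Appended 2026-08-26.) With the all-ones vector in `rs H^X` every `Z`-logical candidate has even weight
(type-12 `EvenWeightLogicals.lean` / `BBEvenDistance.lean`, type-06 `CertParity.lean`), so a `bz` / `bz_aut`
certificate may enumerate only to the EVEN threshold `weff = d − 2` (`[[144,12,12]]`: `W = 10`, director P1;
search-1: "×2 from parity"). The generic lift `forall_succ_lt_of_even` and the one-line BB closer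
`BB.d_eq_of_bzAut_translate_even` (hypotheses = `BB.forall_lt_of_bzAut_translate` at threshold `weff`, `Even weff`,
the printed weight-3 side condition `IsBBPoly` for both polynomials — `BB.isBBPoly_bb144` etc. — and a `Z`-witness of
weight `weff + 2`; conclusion `C.d = weff + 2`). -/

section Parity

variable (C : CSSCode RX RZ Q)

omit [Fintype RX] [Fintype RZ] [DecidableEq Q] in
/-- **Even-weight lift of a lower bound**: if every `z ∈ ker H^X` has even weight, `weff` is even and every
non-trivial `Z`-logical has weight `> weff`, then every non-trivial `Z`-logical has weight `> weff + 1`. -/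
theorem forall_succ_lt_of_even (heven : ∀ z : Q → ZMod 2, C.HX *ᵥ z = 0 → Even (hammingNorm z)) {weff : ℕ}
    (hweff : Even weff) {S : Set (Q → ZMod 2)}
    (hall : ∀ z : Q → ZMod 2, C.HX *ᵥ z = 0 → z ∉ S → weff < hammingNorm z)
    {z : Q → ZMod 2} (hz : C.HX *ᵥ z = 0) (hz' : z ∉ S) : weff + 1 < hammingNorm z := by
  obtain ⟨r, hr⟩ := heven z hz
  obtain ⟨s, hs⟩ := hweff
  have h := hall z hz hz'
  omega

end Parity

section BBParity

open Literature.InformationTheory.QuantumCodes.BB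

variable {ℓ m : ℕ} [NeZero ℓ] [NeZero m] (C : BB.Code ℓ m) {k : ℕ}
  {L Ld : Matrix (Fin k) (Mono ℓ m ⊕ Mono ℓ m) (ZMod 2)}

/-- **`[[n, k, d]]` of `QC(A, B)` from a ONE-SIDED `bz_aut` certificate at the even threshold `weff = d − 2`**:
blocks certified at `weff` (translations as automorphisms, no row-image replay), `Even weff`, the printed
weight-3 side condition on `A` and `B` (⇒ every `Z`-logical has even weight, type-12 `BBEvenDistance`), and a
`Z`-witness of weight `weff + 2` ⇒ `C.d = weff + 2` (`d = d^Z = d^X` by Lemma 1). This is the shape of the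
`[[144,12,12]]` kernel-A closer: `weff = 10`, witness weight `12`. -/
theorem BB.d_eq_of_bzAut_translate_even (hA : IsBBPoly C.A) (hB : IsBBPoly C.B)
    (hdual : ∀ j, C.HZ *ᵥ Ld j = 0) (hpair : ∀ i j, Ld j ⬝ᵥ L i = if i = j then 1 else 0)
    (hdec : ∀ z, C.HX *ᵥ z = 0 → ∃ a : Fin k → ZMod 2, z - ∑ i, a i • L i ∈ C.css.rowSpZ)
    {nb kb jW mm : ℕ} {Gb : Fin nb → Fin kb → (Mono ℓ m ⊕ Mono ℓ m) → ZMod 2}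
    (hrows : ∀ b, C.css.rowSpZ ≤ Submodule.span (ZMod 2) (Set.range (Gb b)))
    {W : Fin nb → Fin jW → Fin k → ZMod 2}
    (hW : ∀ b l, ∑ i, W b l i • L i ∈ Submodule.span (ZMod 2) (Set.range (Gb b)))
    {G : Fin nb → Fin mm → Fin kb → (Mono ℓ m ⊕ Mono ℓ m) → ZMod 2}
    {T : Fin nb → Fin mm → Fin kb → (Mono ℓ m ⊕ Mono ℓ m)}
    (hsys : ∀ b i j j', G b i j (T b i j') = if j = j' then 1 else 0)
    (hG : ∀ b i j, G b i j ∈ Submodule.span (ZMod 2) (Set.range (Gb b)))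
    {t : Fin nb → Fin mm → ℕ} {weff : ℕ} (hweff : Even weff)
    (henum : ∀ b i (a : Fin kb → ZMod 2), 1 ≤ hammingNorm a → hammingNorm a ≤ t b i →
      hammingNorm (∑ j, a j • G b i j) ≤ weff → (∑ j, a j • G b i j) ∈ C.css.rowSpZ)
    (hbound : ∀ b, weff < bzBound (T b) (t b))
    {A : Type*} (τ : A → Mono ℓ m)
    (hcover : ∀ lam : Fin k → ZMod 2, lam ≠ 0 →
      (∃ b, lam ∈ Submodule.span (ZMod 2) (Set.range (W b))) ∨
        ∃ a b, (Ld * (L.submatrix id (BB.Code.translate (τ a)).symm)ᵀ) *ᵥ lam ∈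
          Submodule.span (ZMod 2) (Set.range (W b)))
    {v : Mono ℓ m ⊕ Mono ℓ m → ZMod 2} (hv : C.HX *ᵥ v = 0) (hv' : v ∉ C.css.rowSpZ)
    (hwt : hammingNorm v = weff + 2) : C.d = weff + 2 := by
  have hall : ∀ z, C.HX *ᵥ z = 0 → z ∉ C.css.rowSpZ → weff + 1 < hammingNorm z :=
    fun z hz hz' => forall_succ_lt_of_even C.css
      (fun w hw => C.even_hammingNorm_of_HX_mulVec_eq_zero (odd_hammingNorm_of_isBBPoly hA)
        (odd_hammingNorm_of_isBBPoly hB) hw) hweff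
      (fun w hw hw' => BB.forall_lt_of_bzAut_translate C hdual hpair hdec hrows hW hsys hG henum hbound τ
        hcover hw hw') hz hz'
  rw [C.d_eq_dZ]
  exact dZ_eq_succ_of_forall_lt C.css hv hv' hwt hall

end BBParity

end Summit.Ventures.QEC.Census
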